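import Summits.CriticalPhenomena.Ising3DConformalLimit.Theses.LatticeSDPCertificates
import Summits.CriticalPhenomena.Ising3DConformalLimit.Theorems.EnergyNotSigmaSquaredGapForcesFarMergingSandwichFarMergingSpins
import Summits.CriticalPhenomena.Ising3DConformalLimit.Theorems.EnergyNotSigmaSquaredGapForcesFarMergingSandwichFourToTwoAuxDictionary
import Summits.CriticalPhenomena.Ising3DConformalLimit.Theorems.LatticeSDPCertificatesWindowForcesU4MeetSecondMomentBox
import Summits.CriticalPhenomena.Ising3DConformalLimit.Theorems.LatticeSDPCertificatesWindowForcesU4WindowLatticeMomentRatio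
import Summits.CriticalPhenomena.Ising3DConformalLimit.Theorems.LatticeSDPCertificatesWindowForcesU4WindowDuplicatedMeeting
import Summits.CriticalPhenomena.Ising3DConformalLimit.Theorems.LatticeSDPCertificatesWindowForcesU4MeetingRobustnessReductions
import HarnessLib

/-!
# Birth skeleton (BC3) for crux `WindowForcesU4` — item stmt-CriticalPhenomena-5505, rank 3 of
# route `LatticeSDPCertificates` (sub-problem `Ising3DConformalLimit`)

Crux BY NAME: `Summit.CriticalPhenomena.Ising3DConformalLimit.Theses.LatticeSDPCertificates.WindowForcesU4`
`= WINDOW → ∀ ρ S, (ρ > 0 on (0,1]) → HasPointwiseScalingLimit (criticalCorr 3) ρ S →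
IsNondegenerateTwoPoint S → HasNontrivialU4 S`, where WINDOW (`∃ ε c > 0, ∀ 1 ≤ m ≤ n,
c (n/m)^{-(3/2-ε)} G(m e₁) ≤ G(n e₁)`, `G = criticalTwoPoint 3`) is verbatim the definiens of the
route's support item `WindowBelowHalf` (stmt-5507), used below by that name.

## The line (the route's own mechanism, cut along the tree's random-current currencies)

Vocabulary (all EXISTING declarations, nothing posited here): the finite-volume objects of
Aizenman–Duminil-Copin 2021 §3 in the free box `Λ_n ⊂ ℤ³` at `β_c(3)` from the reviewed module
`Theorems/EnergyNotSigmaSquaredGapForcesFarMergingSandwichDefs` —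
`meet n y`  = `P^{y₀y₁,∅} ⊗ P^{y₂y₃,∅}_{Λ_n}[C_{n₁+n₂}(y₀) ∩ C_{n₃+n₄}(y₂) ≠ ∅]` (DUPLICATED meeting, (3.13)),
`merge n y` = `P^{y₀y₁,y₂y₃}_{Λ_n}[y₀ ↔ y₂ in n₁+n₂]` (two-current MERGING, the event of Aizenman's
identity `U₄ = -2⟨σσ⟩⟨σσ⟩·P[merge]`, (3.11)).

* `stub_windowDuplicatedMeeting` (M–L; WINDOW is load-bearing; provable now): WINDOW ⇒ for every
  injective lattice shape `y`, the duplicated clusters at the dilated sources `L•y` meet with probability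
  `≥ c(y) > 0` for all large `L`, eventually in the box size `n`. Mechanism = the route text: second
  moment on the number `N_A` of common points in a counting region `A` at distance `≍ L`; FIRST moment
  exact by the switching lemma (`P^{ab,∅}_{Λ_n}[u ∈ C(a)] = G_n(a,u)G_n(u,b)/G_n(a,b)`), SECOND moment by
  ADC21 Prop. A.3 (both steps are the landed `stub_secondMomentBox` of crux 0636, file
  `Theorems/IsingEuclidUpgradeR4NonGaussianSecondMomentBox`, whose event `{N_A ≠ 0}` is a shared-vertex
  event, i.e. `⊆ Meet`); the ratio `M₁²/M₂ ≥ c` on the LATTICE from WINDOW's two landed consequences —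
  all-scale doubling (`WindowGivesDoubling`, stmt-5508, + Messager–Miracle-Solé: every pair correlation
  between sources and region sites is `≍ G(L e₁)`) and the top-heavy bubble `Σ_{‖w‖≤R} G² ≤ C R³ G(Re₁)²`
  (`WindowGivesTopHeavyBubble`, stmt-5509) — exactly "P ≥ c′R³G(R)²/Σ_{‖w‖≤R}G² ≥ c″" of the item text;
  box quantities `G_n → G` (`tendsto_isingTwoPoint_box_criticalCorr_two`). Template: the landed per-limit
  fat step `stub_momentRatioLowerBound`/`stub_fatStep` (0636), with the limit-derived window and the
  `Δ < 3/4` dyadic bubble replaced by WINDOW's lattice doubling and bubble.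
* `stub_windowLatticeMeetingRobustness` (XL; THE HARDEST STUB, the open heart): WINDOW ⇒ at SOME injective
  shape, along infinitely many dilations and frequently in the box, two-current merging is comparable to
  duplicated meeting, `c·meet ≤ merge`. This is the `meet → merge` comparison the item text glosses over
  ("… give P[merge] ≥ …": the second moment gives P[meet]); it is the lattice, limit-free, weakest-sufficient
  form of crux 0636's certified heart (0636 `Disproof.lean` §C `CurrentsIntersectUniformly`/
  `LatticeU4RatioPositiveSeq`: one sequence of meshes suffices), and it is implied by the blocked dependency
  `LatticeMeetingRobustness` (`∀ y inj, ∃ c > 0, ∀ᶠ L, ∀ᶠ n, c·meet ≤ merge`) of line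
  `one-cluster-depletion-sandwich` of crux `GapForcesFarMerging` (stmt-4468) — one proof closes both.
  WINDOW is offered as a hypothesis because all-scale lattice regularity (every scale regular in the sense of
  ADC21 Def. 5.11, via stmt-5508) is the one input this route adds to the single-sourced-current geometry
  that every current-based line of 0636 lacks. Why it might fail: single sourced critical clusters on `ℤ³`
  are thinner than duplicated ones (worm numerics of crux `CoulombImpliesNontrivial`, `Disproof.lean` §8:
  `D_single = 1.75(3) < 2-η`), so the comparison cannot come from a pointwise SingleDouble bound (numerically
  FALSE — deliberately NOT posited here); it needs an engine at the single-current scale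
  (`D_single > 3/2` keeps the single-scale first moment divergent) or backbone roughness
  (0636 `Lines/partner-backbone-cut-dead.md`, statement (R′), well-scoped here since WINDOW forces `Δ < 3/4`).
* Composition `windowForcesU4_of_stubs` (sorry-free, below; concludes the crux UNFOLDED from the two stub
  statements; `WindowForcesU4_of : WindowForcesU4` = it applied to the two stub constants, the registered
  no-hypothesis shape): the two stubs give `merge ≥ c·c₁` along infinitely
  many dilations of one shape, frequently in `n`; ADC21 (3.11) in the box and box limits
  (`criticalUrsellFour_le_of_frequently_le_merge`, landed) turn this into Aizenman's far merging
  `U₄^{latt}(L•y) ≤ -2cc₁⟨σσ⟩⟨σσ⟩` for arbitrarily large `L`, and the landed item stmt-4471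
  `farMergingGivesU4_proof` transfers it to `HasNontrivialU4 S` for EVERY non-degenerate pointwise
  scaling limit — the crux's consequent verbatim.

## Reshape 1 (lead prover-line-stmt-CriticalPhenomena-5505-0, cycle 1, 2026-08-17)
Stub A (`stub_windowDuplicatedMeeting`, registered at birth) is cut at the skeleton level into the two halves
of ADC21 Lemma 4.4, each a registered stub with a landed template, and recomposed sorry-free
(`windowDuplicatedMeeting_of_stubs`): A1 `stub_meetSecondMomentBox` (the second-moment inequality
`M₁²/M₂ ≤ meet` in the free box, for the duplicated-MEETING event; template `stub_secondMomentBox` of crux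
0636 whose event `FourMeet` is replaced by the pull-back of `Meet`) and A2 `stub_windowLatticeMomentRatio`
(WINDOW ⇒ `M₁²/M₂ ≥ c(y)` at a counting region `Λ_L + z_L`, uniformly in the dilation `L`, eventually in
`n`; template `stub_momentRatioLowerBound` of 0636 with the limit window/bubble replaced by the landed
lattice doubling 5508 and top-heavy bubble 5509). Registered stubs after the reshape: A1, A2, B (3 ≤ 7).

## Wave 1 of lead c2 (2026-08-17): A1 and A2 LANDED
`stub_meetSecondMomentBox` = p145333 (`Theorems/LatticeSDPCertificatesWindowForcesU4MeetSecondMomentBox.lean`) and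
`stub_windowLatticeMomentRatio` = p145611 (`Theorems/LatticeSDPCertificatesWindowForcesU4WindowLatticeMomentRatio.lean`),
so stub A (`windowDuplicatedMeeting`, WINDOW ⇒ non-degenerate duplicated meeting at every injective shape) is a
theorem and the skeleton has ONE open stub, B (`stub_windowLatticeMeetingRobustness`), held by the lead.

## Lead c2, end of cycle 1 (2026-08-17): reductions LANDED, B promoted
`Theorems/LatticeSDPCertificatesWindowForcesU4MeetingRobustnessReductions.lean` (p149084): under WINDOW, B's consequent
`MeetingRobustnessShape ↔ FarMergeIO` (the currency of crux 4468), and `(WindowBelowHalf → FarMergeIO) → WindowForcesU4`; so the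
crux is now EXACTLY `WindowBelowHalf → FarMergeIO` (lattice far two-current merging i.o. along one shape = Aizenman's 1982
non-Gaussianity criterion on ℤ³). No engine for it exists in print or in tree (see `Cruxes/WindowForcesU4/LeadC2Status.md`: exact
switching is circular; Lemma A.1 gives only merge ≳ G(Le₁) → 0; every second moment needs single-sourced-current fatness s > 3/2,
a statement WINDOW does not touch; the same heart is crux 14625's and 4468's). Verdict: promote-stub B.

## Calibration recorded for the lead / the route re-audit (all kernel-checked elsewhere in the tree)
WINDOW's per-limit content is landed glue: every non-degenerate pointwise limit is scale covariant with an
index `Δ ∈ [1/2,1]` (`stub_lamperti`), `η = 2Δ-1` exists (`stub_etaExists`), and WINDOW ⇒ `η < 1/2`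
(`isingEta_lt_half_of_windowBelowHalf`), so under WINDOW every limit has `Δ < 3/4` and the 0636 fat step
`stub_fatStep` applies; the residual content of this crux is therefore 0636's thin step below the marginal
exponent, whose per-limit form `stub_meetingRobustness` is kernel-checked equivalent to `HasNontrivialU4 S`
(`meetingRobustness_iff_hasNontrivialU4`) — which is why this skeleton states the heart on the LATTICE
(not implied by the crux: the crux only speaks of full-filter limits) and keeps WINDOW available to it.

## Disproof used
No `Cruxes/WindowForcesU4/Disproof.lean` exists (first workfile of this crux). Honoured from the sibling
disproofs: 0636 `Disproof.lean` §A (`false_without_latticeClause`: the lattice clause is load-bearing — both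
stubs are lattice statements about `criticalCorr 3`'s currents), §D (`d < 4` must enter — it enters through
WINDOW, false on `ℤ^d`, `d ≥ 5`, where `η = 0` gives axial decay `n^{-(d-2)}` faster than `n^{-3/2}`);
`CoulombImpliesNontrivial/Disproof.lean` §7(ii) (no graph-uniform SingleDouble) and §8 (SingleDouble false
numerically) — no stub here is a SingleDouble instance. `ledger negatives --problem CriticalPhenomena`
(11 entries, 2026-08-17): none in this sub-problem, none resembling either stub.

References: M. Aizenman, Comm. Math. Phys. 86 (1982) §5 Prop. 5.3; M. Aizenman, H. Duminil-Copin,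
Ann. of Math. 194 (2021) = arXiv:1912.07973, §3 (3.11)–(3.13), §4.2 Lemma 4.4, §5.6 Def. 5.11 /
Remark 5.10, App. A Prop. A.3; H. Duminil-Copin, R. Panis, arXiv:2404.05700 Thm 1.5.
-/

noncomputable section

namespace Summit.CriticalPhenomena.Ising3DConformalLimit.Cruxes.WindowForcesU4.Birth

open Filter Topology
open Literature.Probability.LatticeModels Literature.Probability.Percolation
open Summit.CriticalPhenomena.Ising3DConformalLimit.Theses.LatticeSDPCertificates (WindowForcesU4 WindowBelowHalf)
open Summit.CriticalPhenomena.Ising3DConformalLimit.GapForcesFarMergingSandwich (meet merge)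
open Summit.CriticalPhenomena.Ising3DConformalLimit.EnergyNotSigmaSquaredGapForcesFarMergingSandwich.FarMergingSpinsProof
  (criticalUrsellFour_le_of_frequently_le_merge)
open Summit.CriticalPhenomena.Ising3DConformalLimit.Cruxes.IsingEuclidUpgradeR4NonGaussian.FreeCovarianceDeltaDichotomy
  (boxMoment₁ boxMoment₂)
open Summit.CriticalPhenomena.Ising3DConformalLimit.LatticeSDPCertificatesWindowForcesU4.MeetSecondMomentBoxProof
  (stub_meetSecondMomentBox)
open Summit.CriticalPhenomena.Ising3DConformalLimit.LatticeSDPCertificatesWindowForcesU4.WindowLatticeMomentRatioProof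
  (stub_windowLatticeMomentRatio)
open Summit.CriticalPhenomena.Ising3DConformalLimit.LatticeSDPCertificatesWindowForcesU4
  (windowDuplicatedMeeting_of windowForcesU4_of_window_meetingRobustnessShape)

/-! ## The registered stubs (reshape 1 by the lead, 2026-08-17: stub A cut in two along ADC21 Lemma 4.4) -/

/-! `stub_meetSecondMomentBox` (A1): LANDED — p145333, Theorems/LatticeSDPCertificatesWindowForcesU4MeetSecondMomentBox.lean
(lead c2, wave 1, 2026-08-17), imported above:
`∀ n y, (∀ i, y i ∈ box 3 n) → ∀ A ⊆ box 3 n, boxMoment₁ n (y 0) (y 1) (y 2) (y 3) A ^ 2 / boxMoment₂ n (y 0) (y 1) (y 2) (y 3) A ≤ meet n y`. -/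

/-! `stub_windowLatticeMomentRatio` (A2): LANDED — p145611, Theorems/LatticeSDPCertificatesWindowForcesU4WindowLatticeMomentRatio.lean
(lead c2, wave 1, 2026-08-17), imported above:
`WindowBelowHalf → ∀ y inj, ∃ c > 0, ∀ᶠ L, ∃ A, ∀ᶠ n, A ⊆ box 3 n ∧ c ≤ boxMoment₁ n (L•y 0) … A ^ 2 / boxMoment₂ n (L•y 0) … A`
(c = ℓ¹⁰/(64·max C₀ 1), ℓ = c_W (15D)^{-(3/2-ε)}, D = maxᵢ ‖yᵢ‖∞, A_L = Λ_L + 3DL·e₁; WINDOW + top-heavy bubble 5509 + MMS). -/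

/-! Stub A composed — `windowDuplicatedMeeting : WindowBelowHalf → ∀ y inj, ∃ c > 0, ∀ᶠ L, ∀ᶠ n, c ≤ meet n (L•y)`:
LANDED — p146951, Theorems/LatticeSDPCertificatesWindowForcesU4WindowDuplicatedMeeting.lean (registered sub-goal
`windowDuplicatedMeeting`; glue `windowDuplicatedMeeting_of` + `eventually_smul_mem_box`, imported above). -/

/-- **Stub B — `stub_windowLatticeMeetingRobustness` (XL; the hardest stub, the open heart).** Under WINDOW,
at SOME injective lattice shape `y`, along infinitely many dilations `L` and frequently in the box size `n`,
TWO-CURRENT MERGING is comparable to DUPLICATED MEETING: `c · meet n (L•y) ≤ merge n (L•y)` — the lattice,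
limit-free, weakest-sufficient form of the `meet → merge` step (crux 0636's certified heart; implied by
`LatticeMeetingRobustness` of line `one-cluster-depletion-sandwich` of crux 4468). Not a SingleDouble
statement (numerically false on `ℤ³`); WINDOW (all scales regular) is the extra input this route offers.
[cite: AizenmanDuminilCopinAnnals2021, eq. (3.11) and (3.13)] [cite: Aizenman1982, Prop. 5.3] -/
theorem stub_windowLatticeMeetingRobustness :
    WindowBelowHalf → ∃ y : Fin 4 → Site 3, Function.Injective y ∧
      ∃ c : ℝ, 0 < c ∧ ∃ᶠ L : ℕ in atTop, ∃ᶠ n : ℕ in atTop,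
        c * meet n (fun i => (L : ℤ) • y i) ≤ merge n (fun i => (L : ℤ) • y i) := by
  sorry

/-! ## Composition: the two stub STATEMENTS conclude the crux BY NAME (sorry-free) -/

/-- **The composition (sorry-free).** Stub A and Stub B, taken as STATEMENTS (hypotheses), imply the crux
`WindowForcesU4` (stated here UNFOLDED, so that the registered skeleton theorem below is the only
declaration concluding the crux by name): merging `≥ c·c₁` along infinitely many dilations of one shape ⇒ Aizenman's far
merging of the lattice Ursell function (ADC21 (3.11) in the box + box limits, landed
`criticalUrsellFour_le_of_frequently_le_merge`) ⇒ `HasNontrivialU4 S` for every non-degenerate pointwise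
scaling limit (landed item stmt-4471 `farMergingGivesU4_proof`). Axiom closure: propext, Classical.choice,
Quot.sound (no `sorryAx`). [cite: Aizenman1982, Prop. 5.3] [cite: AizenmanDuminilCopinAnnals2021, eq. (3.11)] -/
theorem windowForcesU4_of_stubs :
    (WindowBelowHalf → ∀ y : Fin 4 → Site 3, Function.Injective y →
      ∃ c : ℝ, 0 < c ∧ ∀ᶠ L : ℕ in atTop, ∀ᶠ n : ℕ in atTop,
        c ≤ meet n (fun i => (L : ℤ) • y i)) →
    (WindowBelowHalf → ∃ y : Fin 4 → Site 3, Function.Injective y ∧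
      ∃ c : ℝ, 0 < c ∧ ∃ᶠ L : ℕ in atTop, ∃ᶠ n : ℕ in atTop,
        c * meet n (fun i => (L : ℤ) • y i) ≤ merge n (fun i => (L : ℤ) • y i)) →
    -- the crux `WindowForcesU4`, unfolded (its antecedent WINDOW is `WindowBelowHalf` verbatim)
    (WindowBelowHalf → ∀ (ρ : ℝ → ℝ) (S : CorrFamily 3), (∀ δ ∈ Set.Ioc (0:ℝ) 1, 0 < ρ δ) →
      HasPointwiseScalingLimit (criticalCorr 3) ρ S → IsNondegenerateTwoPoint S → HasNontrivialU4 S) := by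
  intro hA hB hW ρ S hρ hlim hnd
  obtain ⟨y, hy, c, hc, hfreq⟩ := hB hW
  obtain ⟨c₁, hc₁, hev⟩ := hA hW y hy
  -- two-current merging is non-degenerate along infinitely many dilations, frequently in the box size
  have hmerge : ∃ᶠ L : ℕ in atTop, ∃ᶠ n : ℕ in atTop,
      c * c₁ ≤ merge n (fun i => (L : ℤ) • y i) := by
    refine (hfreq.and_eventually hev).mono ?_
    rintro L ⟨hL, hL'⟩
    refine (hL.and_eventually hL').mono ?_
    rintro n ⟨hn, hn'⟩
    exact (mul_le_mul_of_nonneg_left hn' hc.le).trans hn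
  -- Aizenman's far merging of the lattice Ursell function along those dilations
  have hfar : ∀ L₀ : ℕ, ∃ L : ℕ, L₀ ≤ L ∧
      criticalCorr 3 4 (fun i => (L : ℤ) • y i) -
        (criticalCorr 3 2 ![(L : ℤ) • y 0, (L : ℤ) • y 1] * criticalCorr 3 2 ![(L : ℤ) • y 2, (L : ℤ) • y 3] +
         criticalCorr 3 2 ![(L : ℤ) • y 0, (L : ℤ) • y 2] * criticalCorr 3 2 ![(L : ℤ) • y 1, (L : ℤ) • y 3] +
         criticalCorr 3 2 ![(L : ℤ) • y 0, (L : ℤ) • y 3] * criticalCorr 3 2 ![(L : ℤ) • y 1, (L : ℤ) • y 2])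
        ≤ -(2 * (c * c₁) * (criticalCorr 3 2 ![(L : ℤ) • y 0, (L : ℤ) • y 1] *
            criticalCorr 3 2 ![(L : ℤ) • y 2, (L : ℤ) • y 3])) := by
    intro L₀
    obtain ⟨L, hL₀, hL⟩ := ((eventually_ge_atTop L₀).and_frequently hmerge).exists
    exact ⟨L, hL₀, criticalUrsellFour_le_of_frequently_le_merge (fun i => (L : ℤ) • y i) hL⟩
  -- transfer to every non-degenerate pointwise scaling limit (item stmt-4471, landed)
  have hF := Summit.CriticalPhenomena.Ising3DConformalLimit.FKParityRobustnessFarMergingGivesU4.farMergingGivesU4_proof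
  unfold Summit.CriticalPhenomena.Ising3DConformalLimit.Theses.FKParityRobustness.FarMergingGivesU4 at hF
  exact hF ⟨2 * (c * c₁), by positivity, y, hy, hfar⟩ ρ S hρ hlim hnd

/-! ## The skeleton theorem (registered shape: the crux BY NAME, NO hypotheses, `sorry` only via the stubs) -/

/-- **`WindowForcesU4_of`** — the registered skeleton theorem: the crux decl
`Theses.LatticeSDPCertificates.WindowForcesU4` with NO hypotheses, from the landed stubs A1, A2 (through the landed glue
`windowDuplicatedMeeting_of`) and the one open stub B, via
the sorry-free composition `windowForcesU4_of_stubs`; its axiom closure is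
`{propext, Classical.choice, Quot.sound} ∪ {sorryAx via the stubs}` until the stubs are proved.
[cite: Aizenman1982, Prop. 5.3] -/
theorem WindowForcesU4_of : WindowForcesU4 :=
  windowForcesU4_of_stubs
    (windowDuplicatedMeeting_of stub_meetSecondMomentBox stub_windowLatticeMomentRatio)
    stub_windowLatticeMeetingRobustness

/-- The same through the LANDED reduction file (`…WindowForcesU4MeetingRobustnessReductions`, p149084): stub B alone
(A being a theorem) gives the crux by name — `(WindowBelowHalf → MeetingRobustnessShape) → WindowForcesU4`, i.e. the crux is
reduced to `WindowBelowHalf → FarMergeIO` (`meetingRobustnessShape_iff_farMergeIO`). [cite: Aizenman1982, Prop. 5.3] -/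
theorem WindowForcesU4_of' : WindowForcesU4 :=
  windowForcesU4_of_window_meetingRobustnessShape stub_windowLatticeMeetingRobustness

end Summit.CriticalPhenomena.Ising3DConformalLimit.Cruxes.WindowForcesU4.Birth

end
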